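import Summits.QuantumFields.YangMills.Theorems.LangevinControlUVFemtoCurvatureTwoPointOffAxisDomination
import Summits.QuantumFields.YangMills.Theorems.LangevinControlUVFemtoCurvatureTwoPointAxisProfileAntitone

/-!
# Stub `stub_profileFold` for line `Sketch` of crux `FemtoCurvatureTwoPointC` (stmt-QuantumFields-16204)

On the periodic torus `(ℤ/L)⁴`, with `P_x^{ij}(U) = N − Re tr ρ(U_p)` (plaquette at `x` in the plane `ij`)
and `E` the expectation under Wilson's lattice Yang–Mills measure, the diagonal covariance
`Cov(P_0^{ij}, P_{s e_ν}^{ij})` at an ARBITRARY lattice separation `s : ℕ` equals the one at the folded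
separation `s' = min (s % L) (L − s % L) ∈ [0, L/2]`:

* periodicity: `((s : ℕ) : ZMod L) = ((s % L : ℕ) : ZMod L)` (`ZMod.natCast_mod`), which settles the
  case `s' = s % L`;
* if the fold picks `s' = L − s % L`, then `(s' : ZMod L) = −(s : ZMod L)`, so `s' e_ν = −(s e_ν)` and the
  evenness `Cov(P_0, P_{−x}) = Cov(P_0, P_x)` of the translation-invariant measure (landed:
  `AxisCovNonneg.cov_pair_eq_origin` / `AxisCovNonneg.cov_origin_neg`) concludes.

The transport between the crux's `P = N − Re tr` and the oriented plaquette functions `WilsonRP.plaqRe` is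
`AxisCovNonneg.orient_exists` (the real trace does not see the orientation) followed by
`AxisCovNonneg.cov_constSub_plaqRe` (`Cov(N − A, N − B) = Cov(A, B)`), exactly as in the landed
`FemtoCurvatureTwoPoint.stub_offAxisDomination`.
-/

set_option autoImplicit false

noncomputable section

open Literature.MathematicalPhysics.QuantumFieldTheory
open Summit.QuantumFields.YangMills.Theorems.FemtoCurvatureTwoPoint.AxisCovNonneg

namespace Summit.QuantumFields.YangMills.Theorems.FemtoCurvatureTwoPointC

/-- **Folding a lattice separation on the torus.** Along the axis `ν` of `(ℤ/L)^d` (`0 < L`) the site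
`s e_ν` is `± s' e_ν` for the folded separation `s' = min (s % L) (L − s % L)`: the sign is `+` when the
fold picks `s % L` (periodicity `ZMod.natCast_mod`) and `−` when it picks `L − s % L`
(`(L − s % L : ZMod L) = −(s : ZMod L)`). Stated as the hypothesis of `AxisCovNonneg.cov_pair_eq_origin`
for the pair `(0, s e_ν)`. [folklore] -/
theorem single_natCast_sub_zero_eq_fold_or {d L : ℕ} (ν : Fin d) (s : ℕ) (hL : 0 < L) :
    (Pi.single ν ((s : ℕ) : ZMod L) : Fin d → ZMod L) - 0 =
        Pi.single ν ((min (s % L) (L - s % L) : ℕ) : ZMod L) ∨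
      (Pi.single ν ((s : ℕ) : ZMod L) : Fin d → ZMod L) - 0 =
        -Pi.single ν ((min (s % L) (L - s % L) : ℕ) : ZMod L) := by
  rw [sub_zero]
  rcases min_choice (s % L) (L - s % L) with h | h <;> rw [h]
  · left
    rw [ZMod.natCast_mod]
  · right
    rw [← Pi.single_neg, Nat.cast_sub (Nat.mod_lt s hL).le, ZMod.natCast_self, zero_sub, neg_neg,
      ZMod.natCast_mod]

/-- **Registered stub `stub_profileFold` of line `Sketch`** (crux `FemtoCurvatureTwoPointC`, signature
verbatim): for every compact `G`, continuous `ρ`, torus `(ℤ/L)⁴`, coupling `β`, plane `i ≠ j`, axis `ν`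
and lattice separation `s : ℕ`, the diagonal covariance `Cov(P_0^{ij}, P_{s e_ν}^{ij})` of the plaquette
fields `P_x^{ij} = N − Re tr ρ(U_p)` under Wilson's measure equals the one at the folded separation
`min (s % L) (L − s % L)`. Periodicity of `ZMod L` plus the evenness `Cov(P_0, P_{−x}) = Cov(P_0, P_x)`
(`AxisCovNonneg.cov_pair_eq_origin`), after the vocabulary transport `AxisCovNonneg.orient_exists` /
`AxisCovNonneg.cov_constSub_plaqRe`. [folklore] -/
theorem stub_profileFold :
    ∀ (G : Type) [Group G] [TopologicalSpace G] [IsTopologicalGroup G] [CompactSpace G]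
        [MeasurableSpace G] [BorelSpace G] (N : ℕ) (ρ : G →* Matrix (Fin N) (Fin N) ℂ), Continuous ρ →
      ∀ (L : ℕ) [NeZero L] (β : ℝ)
        (P : (Fin 4 → ZMod L) → Fin 4 → Fin 4 → GaugeConfig 4 L G → ℝ)
        (E : (GaugeConfig 4 L G → ℝ) → ℝ),
        (P = fun x i j U => (N : ℝ) - (ρ (plaquetteHolonomy U x i j)).trace.re) →
        (E = fun F => wilsonExpectation ρ β F) →
      ∀ (i j ν : Fin 4) (s : ℕ), i ≠ j →
        E (fun U => P 0 i j U * P (Pi.single ν ((s : ℕ) : ZMod L)) i j U)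
            - E (P 0 i j) * E (P (Pi.single ν ((s : ℕ) : ZMod L)) i j) =
          E (fun U => P 0 i j U * P (Pi.single ν ((min (s % L) (L - s % L) : ℕ) : ZMod L)) i j U)
            - E (P 0 i j) * E (P (Pi.single ν ((min (s % L) (L - s % L) : ℕ) : ZMod L)) i j) := by
  intro G _ _ _ _ _ _ N ρ hρ L _ β P E hP hE i j ν s hij
  subst hP hE
  -- an oriented plane for the ordered index pair, then `Cov(N − A, N − B) = Cov(A, B)`
  obtain ⟨q₁, hq₁⟩ := orient_exists ρ hρ (L := L) hij
  simp only [hq₁, cov_constSub_plaqRe ρ hρ β]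
  -- the pair `(0, s e_ν)` differs by `± (fold s) e_ν`
  refine cov_pair_eq_origin ρ β q₁ ?_
  exact single_natCast_sub_zero_eq_fold_or ν s (Nat.pos_of_ne_zero (NeZero.ne L))

end Summit.QuantumFields.YangMills.Theorems.FemtoCurvatureTwoPointC

end
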